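import Mathlib
import Summits.ValiantsHypothesis.ValiantsHypothesis.Theorems.NewtonUnitEquationsTwoProductsUniqueWords

/-! # Brick `stub_engineNoSharing` — crux `TwoProducts` (stmt-ValiantsHypothesis-5906), line `corner-log-linearization`

NO SHARING ⇒ THE VERTEX IS THE LIGHTEST LETTER (lead c8; pure support combinatorics).  For one product
`P = ∏ u_i` of polynomials `u_i ∈ ℂ[x,y]` with constant terms `1` such that no nonzero exponent lies in the
support of two different factors, let `w` be a positive integer weight and `e` a strict minimiser of `w` on
`supp (∏ u − 1)`.  Expanding the product over words `d` (`d i ∈ supp u_i`), `e ≠ 0` (the constant term of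
`∏ u − 1` vanishes) and `e` is the sum of a word with a nonzero entry `d j`, so `w e ≥ w (d j) ≥ m`, the least
weight of a nonzero letter, attained at `a₀ ∈ supp u_{i₀}`.  Conversely the only word summing to `a₀` is the
single-letter word at `i₀` (a word summing to `a₀` has a nonzero entry, componentwise below `a₀` and not
lighter, hence equal to `a₀`, the other entries vanish, and the factor is `i₀` by no sharing), so
`(∏ u)[a₀] = u_{i₀}[a₀] ≠ 0` and `a₀ ∈ supp (∏ u − 1)`.  Strict minimality forces `e = a₀`: the vertex is a
letter of some factor and its weight is `m ≤ w a` for every nonzero letter `a`. [folklore] -/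

set_option linter.dupNamespace false -- single-conjunct summit: `ValiantsHypothesis.ValiantsHypothesis`

namespace Summit.ValiantsHypothesis.ValiantsHypothesis.Theorems.TwoProducts.NoSharing

open scoped BigOperators Classical

open MvPolynomial

open Summit.ValiantsHypothesis.ValiantsHypothesis.Theorems.TwoProducts.UniqueWords

/-- A weight with positive coefficients is monotone for the componentwise order on exponents of `ℂ[x,y]`.
[folklore] -/
theorem ns_weight_mono (w : Fin 2 → ℤ) (hw0 : 0 < w 0) (hw1 : 0 < w 1) (a b : Fin 2 →₀ ℕ) (h : a ≤ b) :
    w 0 * (a 0 : ℤ) + w 1 * (a 1 : ℤ) ≤ w 0 * (b 0 : ℤ) + w 1 * (b 1 : ℤ) := by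
  have h0 : ((a 0 : ℕ) : ℤ) ≤ b 0 := by exact_mod_cast Finsupp.le_def.mp h 0
  have h1 : ((a 1 : ℕ) : ℤ) ≤ b 1 := by exact_mod_cast Finsupp.le_def.mp h 1
  linarith [mul_le_mul_of_nonneg_left h0 hw0.le, mul_le_mul_of_nonneg_left h1 hw1.le]

/-- A weight with positive coefficients strictly increases along a strict componentwise inequality of
exponents of `ℂ[x,y]`. [folklore] -/
theorem ns_weight_lt (w : Fin 2 → ℤ) (hw0 : 0 < w 0) (hw1 : 0 < w 1) (a b : Fin 2 →₀ ℕ) (h : a ≤ b)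
    (hne : a ≠ b) : w 0 * (a 0 : ℤ) + w 1 * (a 1 : ℤ) < w 0 * (b 0 : ℤ) + w 1 * (b 1 : ℤ) := by
  have h0 : ((a 0 : ℕ) : ℤ) ≤ b 0 := by exact_mod_cast Finsupp.le_def.mp h 0
  have h1 : ((a 1 : ℕ) : ℤ) ≤ b 1 := by exact_mod_cast Finsupp.le_def.mp h 1
  rcases Fin.exists_fin_two.mp (DFunLike.ne_iff.mp hne) with h2 | h2
  · have h' : ((a 0 : ℕ) : ℤ) < b 0 := by exact_mod_cast lt_of_le_of_ne (Finsupp.le_def.mp h 0) h2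
    linarith [mul_lt_mul_of_pos_left h' hw0, mul_le_mul_of_nonneg_left h1 hw1.le]
  · have h' : ((a 1 : ℕ) : ℤ) < b 1 := by exact_mod_cast lt_of_le_of_ne (Finsupp.le_def.mp h 1) h2
    linarith [mul_lt_mul_of_pos_left h' hw1, mul_le_mul_of_nonneg_left h0 hw0.le]

/-- Each entry of a word is componentwise below the word's exponent sum. [folklore] -/
theorem ns_entry_le_sum {n : ℕ} (d : Fin n → (Fin 2 →₀ ℕ)) (j : Fin n) : d j ≤ ∑ i, d i :=
  Finset.single_le_sum (fun _ _ => zero_le) (Finset.mem_univ j)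

/-- A word whose exponent sum equals one of its entries vanishes at every other index. [folklore] -/
theorem ns_others_zero {n : ℕ} (d : Fin n → (Fin 2 →₀ ℕ)) (k : Fin n) (h : ∑ i, d i = d k) :
    ∀ l, l ≠ k → d l = 0 := by
  intro l hl
  have hsplit := Finset.sum_erase_add Finset.univ d (Finset.mem_univ k)
  rw [h, add_eq_right] at hsplit
  exact (Finset.sum_eq_zero_iff_of_nonneg fun _ _ => zero_le).mp hsplit l
    (Finset.mem_erase.mpr ⟨hl, Finset.mem_univ l⟩)

/-- **No sharing ⇒ the vertex is the lightest letter.**  Let `u : Fin n → ℂ[x,y]` have constant terms `1`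
and suppose no nonzero exponent lies in the supports of two different factors.  Then every strict minimiser
`e` of a positive integer weight on `supp (∏ u − 1)` is nonzero, is a letter of some factor `u_i`, and its
weight is at most the weight of every nonzero letter of every factor. [folklore] -/
theorem stub_engineNoSharing : ∀ (n : ℕ) (u : Fin n → MvPolynomial (Fin 2) ℂ),
    (∀ i, MvPolynomial.coeff 0 (u i) = 1) →
    (∀ i j, i ≠ j → ∀ a ∈ (u i).support, a ∈ (u j).support → a = 0) →
    ∀ (w : Fin 2 → ℤ), 0 < w 0 → 0 < w 1 → ∀ (e : Fin 2 →₀ ℕ),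
    (e ∈ (∏ i, u i - 1).support ∧ ∀ e' ∈ (∏ i, u i - 1).support, e' ≠ e →
      w 0 * (e 0 : ℤ) + w 1 * (e 1 : ℤ) < w 0 * (e' 0 : ℤ) + w 1 * (e' 1 : ℤ)) →
    e ≠ 0 ∧ ∃ i, e ∈ (u i).support ∧
      ∀ j, ∀ a ∈ (u j).support, a ≠ 0 → w 0 * (e 0 : ℤ) + w 1 * (e 1 : ℤ) ≤ w 0 * (a 0 : ℤ) + w 1 * (a 1 : ℤ) := by
  intro n u hu hns w hw0 hw1 e he
  obtain ⟨he, hmin⟩ := he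
  -- `0` is a letter of every factor
  have h0 : ∀ i, (0 : Fin 2 →₀ ℕ) ∈ (u i).support := fun i =>
    mem_support_iff.mpr (by rw [hu i]; exact one_ne_zero)
  -- the constant term of the product is `1`, so the vertex is nonzero
  have hc0 : coeff 0 (∏ i, u i) = 1 := by
    rw [← constantCoeff_eq, map_prod]
    exact Finset.prod_eq_one fun i _ => by rw [constantCoeff_eq, hu i]
  have he0 : e ≠ 0 := by
    rintro rfl
    exact mem_support_iff.mp he (by rw [coeff_sub, coeff_zero_one, hc0, sub_self])
  -- away from `0`, the coefficients of `∏ u - 1` are those of `∏ u`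
  have hc : ∀ a : Fin 2 →₀ ℕ, a ≠ 0 → coeff a (∏ i, u i - 1) = coeff a (∏ i, u i) := by
    intro a ha
    rw [coeff_sub, coeff_one, if_neg (Ne.symm ha), sub_zero]
  have hce : coeff e (∏ i, u i) ≠ 0 := by
    rw [← hc e he0]
    exact mem_support_iff.mp he
  -- the word `d` of the vertex `e`, with a nonzero entry `d j`
  obtain ⟨d, hd, hde⟩ : ∃ d : Fin n → (Fin 2 →₀ ℕ), (∀ i, d i ∈ (u i).support) ∧ ∑ i, d i = e := by
    by_contra hne
    push Not at hne
    exact hce (uw_coeff_prod_of_no_word u (fun i => (u i).support) (fun _ => subset_rfl) e hne)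
  obtain ⟨j, hj⟩ : ∃ j, d j ≠ 0 := by
    by_contra hall
    push Not at hall
    exact he0 (by rw [← hde]; exact Finset.sum_eq_zero fun i _ => hall i)
  -- the finite, nonempty set of nonzero letters and a letter `a₀ ∈ supp u_{i₀}` of least weight
  have hmemL : ∀ a : Fin 2 →₀ ℕ, a ∈ (Finset.univ.biUnion fun i => ((u i).support).erase 0) ↔
      a ≠ 0 ∧ ∃ i, a ∈ (u i).support := by
    intro a
    rw [Finset.mem_biUnion]
    constructor
    · rintro ⟨i, -, hi⟩
      exact ⟨(Finset.mem_erase.mp hi).1, i, (Finset.mem_erase.mp hi).2⟩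
    · rintro ⟨ha0, i, hai⟩
      exact ⟨i, Finset.mem_univ i, Finset.mem_erase.mpr ⟨ha0, hai⟩⟩
  obtain ⟨a₀, ha₀L, ha₀min⟩ := (Finset.univ.biUnion fun i => ((u i).support).erase 0).exists_min_image
    (fun a => w 0 * (a 0 : ℤ) + w 1 * (a 1 : ℤ)) ⟨d j, (hmemL _).mpr ⟨hj, j, hd j⟩⟩
  obtain ⟨ha₀0, i₀, ha₀i⟩ := (hmemL a₀).mp ha₀L
  have hm : ∀ i, ∀ a ∈ (u i).support, a ≠ 0 →
      w 0 * (a₀ 0 : ℤ) + w 1 * (a₀ 1 : ℤ) ≤ w 0 * (a 0 : ℤ) + w 1 * (a 1 : ℤ) :=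
    fun i a hai ha0 => ha₀min a ((hmemL a).mpr ⟨ha0, i, hai⟩)
  -- the only word summing to `a₀` is the single-letter word at `i₀`
  have hfib : ∀ d' : Fin n → (Fin 2 →₀ ℕ), (∀ i, d' i ∈ (u i).support) → ∑ i, d' i = a₀ →
      d' = Pi.single i₀ a₀ := by
    intro d' hd' hsum
    obtain ⟨k, hk⟩ : ∃ k, d' k ≠ 0 := by
      by_contra hall
      push Not at hall
      exact ha₀0 (by rw [← hsum]; exact Finset.sum_eq_zero fun i _ => hall i)
    -- the nonzero entry `d' k` is componentwise below `a₀` and not lighter, hence equal to `a₀`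
    have hle : d' k ≤ a₀ := by
      rw [← hsum]
      exact ns_entry_le_sum d' k
    have hka : d' k = a₀ := by
      by_contra hne
      have hlt := ns_weight_lt w hw0 hw1 (d' k) a₀ hle hne
      have hge := hm k (d' k) (hd' k) hk
      exact absurd hlt (not_lt.mpr hge)
    have hzero : ∀ l, l ≠ k → d' l = 0 := ns_others_zero d' k (hsum.trans hka.symm)
    -- and `k = i₀` by the no-sharing hypothesis
    have hki : k = i₀ := by
      by_contra hki
      exact ha₀0 (hns k i₀ hki a₀ (hka ▸ hd' k) ha₀i)
    funext l
    by_cases hl : l = i₀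
    · rw [hl, Pi.single_eq_same, ← hki]
      exact hka
    · rw [Pi.single_eq_of_ne hl]
      exact hzero l fun h => hl (h.trans hki)
  have hsingle_mem : ∀ i, (Pi.single i₀ a₀ : Fin n → (Fin 2 →₀ ℕ)) i ∈ (u i).support := by
    intro i
    by_cases hi : i = i₀
    · rw [hi, Pi.single_eq_same]
      exact ha₀i
    · rw [Pi.single_eq_of_ne hi]
      exact h0 i
  have hsingle_sum : ∑ i, (Pi.single i₀ a₀ : Fin n → (Fin 2 →₀ ℕ)) i = a₀ := by
    rw [Fintype.sum_eq_single i₀ fun l hl => Pi.single_eq_of_ne hl _, Pi.single_eq_same]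
  -- hence `(∏ u)[a₀] = u_{i₀}[a₀] ≠ 0` and `a₀ ∈ supp (∏ u - 1)`
  have hca₀ : coeff a₀ (∏ i, u i) = coeff a₀ (u i₀) := by
    rw [uw_coeff_prod u (fun i => (u i).support) (fun _ => subset_rfl) a₀]
    have hf : (Fintype.piFinset fun i => (u i).support).filter (fun d' => ∑ i, d' i = a₀) =
        {(Pi.single i₀ a₀ : Fin n → (Fin 2 →₀ ℕ))} := by
      refine Finset.eq_singleton_iff_unique_mem.mpr ⟨?_, fun d' hd' => ?_⟩
      · exact Finset.mem_filter.mpr ⟨Fintype.mem_piFinset.mpr hsingle_mem, hsingle_sum⟩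
      · obtain ⟨h1, h2⟩ := Finset.mem_filter.mp hd'
        exact hfib d' (Fintype.mem_piFinset.mp h1) h2
    rw [hf, Finset.sum_singleton, Fintype.prod_eq_single i₀ ?_, Pi.single_eq_same]
    intro l hl
    rw [Pi.single_eq_of_ne hl, hu]
  have ha₀supp : a₀ ∈ (∏ i, u i - 1).support := by
    rw [mem_support_iff, hc a₀ ha₀0, hca₀]
    exact mem_support_iff.mp ha₀i
  -- `w a₀ ≤ w e` through the nonzero entry `d j` of the word of `e`; strict minimality gives `e = a₀`
  have hje : d j ≤ e := by
    rw [← hde]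
    exact ns_entry_le_sum d j
  have hWe : w 0 * (a₀ 0 : ℤ) + w 1 * (a₀ 1 : ℤ) ≤ w 0 * (e 0 : ℤ) + w 1 * (e 1 : ℤ) :=
    (hm j (d j) (hd j) hj).trans (ns_weight_mono w hw0 hw1 (d j) e hje)
  have hea : a₀ = e := by
    by_contra hne
    exact absurd (hmin a₀ ha₀supp hne) (not_lt.mpr hWe)
  subst hea
  exact ⟨ha₀0, i₀, ha₀i, fun j a ha ha0 => hm j a ha ha0⟩

end Summit.ValiantsHypothesis.ValiantsHypothesis.Theorems.TwoProducts.NoSharing
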